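import Literature.NumberTheory.EllipticCurves.SkinnerZhang2014.MultiplicativeIndivisibility
import Literature.NumberTheory.EllipticCurves.Selmer
import HarnessLib

/-!
# Skinner–Zhang 2014 (arXiv:1407.1099, UNREFEREED), Thm. 1.1: the `p`-converse theorem at a prime `p ‖ N`

HONEST FRAMING (cell `b2b-bsdres`; BSD-DENSITY SPRINT book `cells/density/CONVERSION-QUEUE.md`,
row Q2 `h9`, multiplicative-at-`5` leg): published theorems only; an UNREFEREED preprint enters
only as an explicitly labelled OPEN hypothesis (suffix `_OPEN`, tag `[claim: …, status: under-review]`),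
exactly as the sibling file `MultiplicativeIndivisibility.lean` does for Thm. 1.2 of the same
preprint. A class theorem / density count using it is CONDITIONAL on an unrefereed claim and must
print the label («literal-PRE» in the sprint's vocabulary). Nothing here is a theorem of the tree.

Source: C. Skinner, W. Zhang, *Indivisibility of Heegner points in the multiplicative case*,
arXiv:1407.1099v1 (4 July 2014), §1, Theorem 1.1 (store `paper:arxiv-1407.1099`, chunk p0003
L19–L36). **STATUS: PREPRINT since 2014, never published** (arXiv v1 only; no journal version as of
August 2026 — `FRESHNESS.md` rows "1407.1099 v1"; pub-bsdpct `AUDIT.md` §B2.3). This is the input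
"[SZ14]" of Bhargava–Skinner–Zhang, arXiv:1407.1826, Thm. 9 at a prime `p` of multiplicative
reduction (conditions (c)–(e) there), hence of the multiplicative-at-`5` slice of the binder `h9` of
the tree's `Literature.NumberTheory.EllipticCurves.bsz_rankLeOne_cRank_of_pieces`
(`LeadingTermBSZResCellAssemblyProofs.lean`; pub-bsdpct `main.tex` Table "Theorem A′ … [BS5], [SZ14]").

Printed text (chunk p0003 L19–L36), verbatim: "Theorem 1.1. Let `E/ℚ` be an elliptic curve with
conductor `N` and minimal discriminant `Δ` and let `p ≥ 5` be a prime. Suppose (a) `E` has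
multiplicative reduction at `p` (equivalently, `p ∣∣ N`); (b) `p ∤ ord_p(Δ)`, and if `E` has split
multiplicative reduction at `p` then `log_p q_E ∈ pℤ_p^×`, where `q_E ∈ ℚ_p^×` is the Tate period of
`E/ℚ_p`; (c) `E[p]` is an irreducible `Gal(ℚ̄/ℚ)`-module; (d) for all primes `ℓ ∣∣ N` such that
`ℓ ≡ ±1 (mod p)`, `p ∤ ord_ℓ(Δ)`; (e) there exist at least two prime factors `ℓ ∣∣ N` such that
`p ∤ ord_ℓ(Δ)`; (f) the `p^∞`-Selmer group `Sel_{p^∞}(E/ℚ)` has `ℤ_p`-corank one. Then the rank and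
analytic rank of `E/ℚ` are both equal to `1` and the Tate-Shafarevich group `Ш(E/ℚ)` is finite."

## Transcription (the sibling file's conventions, unchanged)

Hypotheses (a)–(e) = the sibling's predicate `SkinnerZhang2014.Hypotheses W p` (global minimal `W`,
so `W.minimalDiscriminantInt = Δ`; `ℓ ∣∣ N` = multiplicative reduction at `ℓ`; (b)'s second clause
through `TateParameterData` / `padicLog`, "`∈ pℤ_p^×`" = "valuation `1`"); (f) = `W.selmerCorank p = 1`
(the tree's `ℤ_p`-corank of `Sel_{p^∞}(E/ℚ)`, `Selmer.lean`, as in the W. Zhang 2014 file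
`WZhang2014/SelmerCorankOnePConverse.lean`); conclusions `W.mordellWeilRank = 1`,
`W.analyticRank = 1`, `Finite W.sha`. `p ≥ 5` kept as `5 ≤ p`. Nothing is weakened or
strengthened; no hypothesis is dropped.

By-name consumer (D-0026): the D2 glue of the sprint's binder `h9` on the multiplicative-at-`5` part
of `T ∩ S₁ ∩ W` (cell book row Q2; the good-ordinary part is W. Zhang 2014 Thm. 1.4 (i) = registry
A322), via the tree's `#Sel⁽ᵖ⁾ = p ∧ #E(ℚ)[p] = 1 ⟹ corank 1`
(`SelmerCardinalityPConverses.selmerCorank_eq_one_of_natCard_selmerGroup_eq`). Whether that slice is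
CARRIED with the label, RE-PRICED, or DROPPED is the sprint lead's fork (q3); this file only makes the
"carried, labelled «literal-PRE»" option available verbatim.
-/

noncomputable section

open scoped Classical

open WeierstrassCurve

namespace Literature.NumberTheory.EllipticCurves.SkinnerZhang2014

/-- **OPEN HYPOTHESIS — UNREFEREED PREPRINT (arXiv:1407.1099v1, 2014; no journal version as of
August 2026).** Skinner–Zhang, *Indivisibility of Heegner points in the multiplicative case*,
Thm. 1.1 (§1, p. 1; store `paper:arxiv-1407.1099` chunk p0003 L19–L36): "Let `E/ℚ` be an elliptic
curve with conductor `N` and minimal discriminant `Δ` and let `p ≥ 5` be a prime. Suppose (a) `E` has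
multiplicative reduction at `p` (equivalently, `p ∣∣ N`); (b) `p ∤ ord_p(Δ)`, and if `E` has split
multiplicative reduction at `p` then `log_p q_E ∈ pℤ_p^×`, where `q_E ∈ ℚ_p^×` is the Tate period of
`E/ℚ_p`; (c) `E[p]` is an irreducible `Gal(ℚ̄/ℚ)`-module; (d) for all primes `ℓ ∣∣ N` such that
`ℓ ≡ ±1 (mod p)`, `p ∤ ord_ℓ(Δ)`; (e) there exist at least two prime factors `ℓ ∣∣ N` such that
`p ∤ ord_ℓ(Δ)`; (f) the `p^∞`-Selmer group `Sel_{p^∞}(E/ℚ)` has `ℤ_p`-corank one. Then the rank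
and analytic rank of `E/ℚ` are both equal to `1` and the Tate-Shafarevich group `Ш(E/ℚ)` is
finite." Transcribed with (a)–(e) = `Hypotheses W p` (sibling file, global minimal `W`),
(f) = `W.selmerCorank p = 1`, conclusions `W.mordellWeilRank = 1 ∧ W.analyticRank = 1 ∧ Finite W.sha`.
The printed proof rests on the paper's Thm. 1.3 (Kolyvagin's non-vanishing mod `p` at `p ∣∣ N`),
the Gross–Zagier formula on Shimura curves and Skinner's multiplicative IMC (Pacific J. Math. 283
(2016)). NEVER cite this `Prop` as a theorem: take it as an explicit hypothesis
`(hSZ : SkinnerZhang2014.thm1_1_rank_one_of_selmerCorank_eq_one_OPEN)`; a result using it is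
conditional on an unrefereed claim («literal-PRE»). [claim: SkinnerZhang2014, status: under-review] -/
def thm1_1_rank_one_of_selmerCorank_eq_one_OPEN : Prop :=
  ∀ (W : WeierstrassCurve ℚ) [W.IsElliptic] [W.IsGloballyMinimal] (p : ℕ) [Fact p.Prime],
    5 ≤ p → Hypotheses W p → W.selmerCorank p = 1 →
    W.mordellWeilRank = 1 ∧ W.analyticRank = 1 ∧ Finite W.sha

/-- Reading of the claim in the shape the sprint's glue consumes (rank and analytic rank only),
CONDITIONAL on the open hypothesis `hSZ`. [claim: SkinnerZhang2014, status: under-review] -/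
theorem rank_eq_one_and_analyticRank_eq_one_of_thm1_1_OPEN
    (hSZ : thm1_1_rank_one_of_selmerCorank_eq_one_OPEN)
    (W : WeierstrassCurve ℚ) [W.IsElliptic] [W.IsGloballyMinimal] (p : ℕ) [Fact p.Prime]
    (hp : 5 ≤ p) (hH : Hypotheses W p) (hf : W.selmerCorank p = 1) :
    W.mordellWeilRank = 1 ∧ W.analyticRank = 1 :=
  ⟨(hSZ W p hp hH hf).1, (hSZ W p hp hH hf).2.1⟩

/-- And `Ш(E/ℚ)` is finite, CONDITIONAL on `hSZ` (third printed conclusion).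
[claim: SkinnerZhang2014, status: under-review] -/
theorem finite_sha_of_thm1_1_OPEN (hSZ : thm1_1_rank_one_of_selmerCorank_eq_one_OPEN)
    (W : WeierstrassCurve ℚ) [W.IsElliptic] [W.IsGloballyMinimal] (p : ℕ) [Fact p.Prime]
    (hp : 5 ≤ p) (hH : Hypotheses W p) (hf : W.selmerCorank p = 1) : Finite W.sha :=
  (hSZ W p hp hH hf).2.2

end Literature.NumberTheory.EllipticCurves.SkinnerZhang2014

end
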